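import Mathlib
import Summits.ResolutionOfSingularities.ResolutionOfSingularities.Theorems.WeightedInvariantLocalWeightedDropNCResSurfGraphTangent
import Summits.ResolutionOfSingularities.ResolutionOfSingularities.Theorems.WeightedInvariantLocalWeightedDropNCResCurveGraphChart
import Summits.ResolutionOfSingularities.ResolutionOfSingularities.Theorems.WeightedInvariantLocalWeightedDropTOT2CurveConflictDivTwo
import Summits.ResolutionOfSingularities.ResolutionOfSingularities.Theorems.WeightedInvariantLocalWeightedDropNCGameToricCalculus

/-!
# `WeightedInvariant.LocalWeightedDrop`: NC-resolution settings for the TOT₂ line — GRAPH SURFACES, part 6: the CHART IDENTITY of the identity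
# point move at a tangent-plane answer (the strict transform of a graph surface is a graph surface over the exceptional letter and the transported
# base letter) and the PERMISSIBILITY of the new base plane

Crux item stmt-ResolutionOfSingularities-8899 `LocalWeightedDrop` (route `ResolutionOfSingularities/WeightedInvariant`), ENGINE skeleton v32/v33, residuals
`stub_spaceNCRankDrop` / `stub_wildWideApexFourStartsWon` (res-L1-w43-strat-1's line `directrix-cut` v3.1, piece PL = `ApexPlaneExit`, SURFACE sub-case;
design memo `L/res-L1-w43-stub-4/g5/S-E2-SURF.md`).  [OURS · L1 W4.3 · chain w43 · seat res-L1-w43-stub-4 gen 5; three bookkeeping definitions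
(`divX₁`, `stepSeries₂`, `step₂`) + the identity; the two-variable twin of res-type-056's `…NCResCurveGraphChart` ((C2) `subst_chart_shear`, (C3)
`inOffIdeal_chart_step`), whose chart family `x_l ↦ s · (c′_l + y_{l′})` (`GraphCurve.hasSubst_chart`) is reused; the count game is the programme's own;
nothing here is a statement of any manuscript; AI-produced, gate-checked, weaker than expert review.]

SETTING.  A graph surface `S = {x_j = ψ_j(x_a, x_b)}` over the base letters `a ≠ b`, the identity point move, and an answer `c′` in the tangent plane
with `c′_a ≠ 0` (part 5: every same-head answer is of this form, up to swapping `a ↔ b`), read at the live slot `a`.  The successor's letters are `s`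
(index `0`) and `y_{l′}`, `l′ = predAbove a (succ l)` for `l ≠ a`; the strict transform of `S` is the graph over the NEW base `(b′, 0)`,
`b′ = predAbove a (succ b)`: `y_{j′} = ψ′_{j′}(y_{b′}, s)` with `ψ′_{j′}(u, s) = (ψ_j(c′_a s, s(c′_b + u)) − c′_j s)/s`.
* `divX₁`, `X_one_mul_divX₁` — division by the second variable of `k⟦u, s⟧` (on multiples of it);
* `stepSeries₂ ψ λ μ a := (ψ(λ s, s(μ + u)) − a s)/s`, `X_one_mul_stepSeries₂`, `constantCoeff_stepSeries₂`;
* `step₂ a b ψ c′` — the successor graph datum, indexed by the successor's letters;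
* **`subst_chart_shear₂`** — (C2): `ρ₀ ∘ shear_{a,b}(ψ) = shear_{b′,0}(step₂) ∘ ρ_{c′,a}` on every germ, where `ρ_{c′,a}` is the chart `x_l ↦ s(c′_l + y_{l′})`
  (`x_a ↦ c′_a s`) and `ρ₀` the same chart at the point `(c′_a, c′_b, 0, …)` of the graph coordinates;
* **`inOffPlaneIdeal_chart_step₂`** — (C3): if the base plane is permissible at order `c` for `shear_{a,b}(ψ)^* F`, then the new base plane is permissible
  at order `c` for `shear_{b′,0}(step₂)^* (ρ_{c′,a}^* F)` (part 2's transport `InOffPlaneIdeal.subst`).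
-/

set_option linter.dupNamespace false -- mandated namespace of this single-conjunct summit

noncomputable section

namespace Summit.ResolutionOfSingularities.ResolutionOfSingularities.Theorems

namespace TameFourTupleDrop

namespace GraphSurf

open MvPowerSeries Literature.AlgebraicGeometry.Resolution

variable {k : Type} [Field k] {m : ℕ}

/-! ## Division by the second variable of `k⟦u, s⟧` -/

/-- `F / s` on two-variable series (shift of the exponent of the second variable; meaningful when `s ∣ F`). [OURS] -/
def divX₁ (F : MvPowerSeries (Fin 2) k) : MvPowerSeries (Fin 2) k :=
  fun e => coeff (e + Finsupp.single 1 1) F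

/-- Coefficients of `F / s`. -/
theorem coeff_divX₁ (F : MvPowerSeries (Fin 2) k) (e : Fin 2 →₀ ℕ) : coeff e (divX₁ F) = coeff (e + Finsupp.single 1 1) F := rfl

/-- `s · (F / s) = F` when `s ∣ F`. -/
theorem X_one_mul_divX₁ {F : MvPowerSeries (Fin 2) k} (h : (X 1 : MvPowerSeries (Fin 2) k) ∣ F) : X 1 * divX₁ F = F := by
  classical
  rw [X_dvd_iff] at h
  ext e
  rw [X, coeff_monomial_mul]
  by_cases he : Finsupp.single (1 : Fin 2) 1 ≤ e
  · rw [if_pos he, one_mul, coeff_divX₁, tsub_add_cancel_of_le he]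
  · rw [if_neg he]
    refine (h e ?_).symm
    by_contra hne
    exact he (Finsupp.single_le_iff.mpr (Nat.one_le_iff_ne_zero.mpr hne))

/-! ## The two-variable step series -/

/-- The substitution family of the chart at a tangent-plane answer, read on the base letters: `x_a ↦ λ s`, `x_b ↦ s (μ + u)` (`u = X 0`, `s = X 1`). -/
theorem hasSubst_chartBase (lam mu : k) :
    HasSubst (![C lam * X 1, X 1 * (C mu + X 0)] : Fin 2 → MvPowerSeries (Fin 2) k) :=
  hasSubst_of_constantCoeff_zero fun t => by fin_cases t <;> simp [constantCoeff_X]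

/-- Every component of that family is a multiple of `s`. -/
theorem X_one_dvd_chartBase (lam mu : k) (t : Fin 2) :
    (X 1 : MvPowerSeries (Fin 2) k) ∣ (![C lam * X 1, X 1 * (C mu + X 0)] : Fin 2 → MvPowerSeries (Fin 2) k) t := by
  fin_cases t
  · exact ⟨C lam, by simp [mul_comm]⟩
  · exact ⟨C mu + X 0, by simp⟩

/-- `s` divides `ψ(λ s, s(μ + u))` when `ψ(0) = 0`. -/
theorem X_one_dvd_subst_chartBase (lam mu : k) {ψ : MvPowerSeries (Fin 2) k} (h0 : constantCoeff ψ = 0) :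
    (X 1 : MvPowerSeries (Fin 2) k) ∣ subst ![C lam * X 1, X 1 * (C mu + X 0)] ψ := by
  classical
  -- kill `s`: the substitution `(u, s) ↦ (u, 0)` annihilates every component, hence the composite is `ψ(0) = 0`
  rw [TOT2Curve.X_one_dvd_iff_killTwo_eq_zero, subst_comp_subst_apply (hasSubst_chartBase lam mu) TOT2Curve.hasSubst_killTwo]
  have hfam : (fun t => subst (![X 0, 0] : Fin 2 → MvPowerSeries (Fin 2) k)
      ((![C lam * X 1, X 1 * (C mu + X 0)] : Fin 2 → MvPowerSeries (Fin 2) k) t)) = fun _ => 0 := by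
    funext t
    fin_cases t
    · simp [subst_mul TOT2Curve.hasSubst_killTwo, subst_X TOT2Curve.hasSubst_killTwo]
    · simp [subst_mul TOT2Curve.hasSubst_killTwo, subst_X TOT2Curve.hasSubst_killTwo]
  rw [hfam]
  ext e
  rw [coeff_subst (hasSubst_of_constantCoeff_zero fun _ => map_zero _), map_zero, finsum_eq_zero_of_forall_eq_zero]
  intro d
  by_cases hd : d = 0
  · rw [hd, MvPowerSeries.coeff_zero_eq_constantCoeff_apply, h0, zero_smul]
  · obtain ⟨t, ht⟩ := Finsupp.ne_iff.mp hd
    rw [Finsupp.prod, ← Finset.mul_prod_erase _ _ (Finsupp.mem_support_iff.mpr ht), zero_pow ht, zero_mul, map_zero, smul_zero]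

/-- THE TWO-VARIABLE STEP SERIES `(ψ(λ s, s(μ + u)) − a s)/s`: the graph component, over the new base `(u, s)`, of the strict transform of the surface
under the identity point move at the tangent-plane answer `(λ, μ)` read at the slot `a` (`a = c′_j = λ ∂₁ψ_j(0) + μ ∂₂ψ_j(0)`). [OURS] -/
def stepSeries₂ (ψ : MvPowerSeries (Fin 2) k) (lam mu a : k) : MvPowerSeries (Fin 2) k :=
  divX₁ (subst ![C lam * X 1, X 1 * (C mu + X 0)] ψ - C a * X 1)

/-- `s · stepSeries₂ = ψ(λ s, s(μ + u)) − a s` when `ψ(0) = 0`. -/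
theorem X_one_mul_stepSeries₂ {ψ : MvPowerSeries (Fin 2) k} (h0 : constantCoeff ψ = 0) (lam mu a : k) :
    X 1 * stepSeries₂ ψ lam mu a = subst ![C lam * X 1, X 1 * (C mu + X 0)] ψ - C a * X 1 :=
  X_one_mul_divX₁ ((X_one_dvd_subst_chartBase lam mu h0).sub (Dvd.intro_left _ rfl))

/-- The step series has zero constant term when `a = λ ∂₁ψ(0) + μ ∂₂ψ(0)` (the answer lies in the tangent plane). -/
theorem constantCoeff_stepSeries₂ {ψ : MvPowerSeries (Fin 2) k} {lam mu a : k}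
    (ha : a = lam * coeff (Finsupp.single 0 1) ψ + mu * coeff (Finsupp.single 1 1) ψ) :
    constantCoeff (stepSeries₂ ψ lam mu a) = 0 := by
  classical
  have hσ0 : ∀ t, constantCoeff ((![C lam * X 1, X 1 * (C mu + X 0)] : Fin 2 → MvPowerSeries (Fin 2) k) t) = 0 := fun t => by
    fin_cases t <;> simp [constantCoeff_X]
  -- the `s`-linear coefficients of the two components: `λ` and `μ`
  have h1a : coeff (Finsupp.single 1 1) (C lam * X 1 : MvPowerSeries (Fin 2) k) = lam := by
    rw [coeff_C_mul, coeff_X, if_pos rfl, mul_one]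
  have h1b : coeff (Finsupp.single 1 1) (X 1 * (C mu + X 0) : MvPowerSeries (Fin 2) k) = mu := by
    rw [mul_add, map_add, mul_comm (X 1) (C mu), coeff_C_mul, coeff_X, if_pos rfl, mul_one,
      show (X 1 : MvPowerSeries (Fin 2) k) * X 0 = monomial (Finsupp.single 1 1 + Finsupp.single 0 1) 1 by
        rw [X, X, monomial_mul_monomial, one_mul], coeff_monomial, if_neg, add_zero]
    intro h
    have h0 := Finsupp.ext_iff.mp h 0
    simp at h0
  -- the constant term of `F/s` is the `s`-coefficient of `F`
  rw [← coeff_zero_eq_constantCoeff_apply, stepSeries₂, coeff_divX₁, zero_add, map_sub, coeff_C_mul, coeff_X, if_pos rfl, mul_one,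
    NCTransport.coeff_single_subst_eq_sum_of_constantCoeff_zero hσ0 ψ 1, Fin.sum_univ_two]
  simp only [Matrix.cons_val_zero, Matrix.cons_val_one]
  rw [h1a, h1b, ha]
  ring

/-! ## The successor graph datum and the chart identity -/

/-- THE SUCCESSOR GRAPH DATUM at the tangent-plane answer `c′` read at the slot `a`, indexed by the successor's letters: `0 ↦ 0` (the exceptional
letter is a base letter), `p.succ ↦ stepSeries₂ (ψ_{a.succAbove p}) c′_a c′_b c′_{a.succAbove p}` (the component at the transported base letter
`b′ = predAbove a (succ b)` is never read). [OURS] -/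
def step₂ (a b : Fin (m + 1)) (ψ : Fin (m + 1) → MvPowerSeries (Fin 2) k) (c' : Fin (m + 1) → k) :
    Fin (m + 1) → MvPowerSeries (Fin 2) k :=
  fun j' => Fin.cases (motive := fun _ => MvPowerSeries (Fin 2) k) 0
    (fun p => stepSeries₂ (ψ (a.succAbove p)) (c' a) (c' b) (c' (a.succAbove p))) j'

/-- Values of the successor datum. -/
theorem step₂_zero (a b : Fin (m + 1)) (ψ : Fin (m + 1) → MvPowerSeries (Fin 2) k) (c' : Fin (m + 1) → k) : step₂ a b ψ c' 0 = 0 := by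
  simp [step₂]

/-- Values of the successor datum. -/
theorem step₂_succ (a b : Fin (m + 1)) (ψ : Fin (m + 1) → MvPowerSeries (Fin 2) k) (c' : Fin (m + 1) → k) (p : Fin m) :
    step₂ a b ψ c' p.succ = stepSeries₂ (ψ (a.succAbove p)) (c' a) (c' b) (c' (a.succAbove p)) := by
  simp [step₂]

/-- The successor datum has zero constant terms off the new base (at a tangent-plane answer). -/
theorem constantCoeff_step₂_of_ne {a b : Fin (m + 1)} (ψ : Fin (m + 1) → MvPowerSeries (Fin 2) k) {c' : Fin (m + 1) → k}
    (hc' : ∀ j, ¬ (j = a ∨ j = b) → c' j = c' a * coeff (Finsupp.single 0 1) (ψ j) + c' b * coeff (Finsupp.single 1 1) (ψ j))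
    (j' : Fin (m + 1)) (hj' : ¬ (j' = Fin.predAbove a b.succ ∨ j' = 0)) : constantCoeff (step₂ a b ψ c' j') = 0 := by
  obtain ⟨p, rfl⟩ : ∃ p : Fin m, p.succ = j' := Fin.exists_succ_eq.mpr (fun h => hj' (Or.inr h))
  rw [step₂_succ]
  refine constantCoeff_stepSeries₂ (hc' _ ?_)
  rintro (h | h)
  · exact Fin.succAbove_ne a p h
  · apply hj'
    left
    rw [← h, RestrictedChartTransport.predAbove_succAbove_succ]

/-- The successor shear may be substituted. -/
theorem hasSubst_shear_step₂ {a b : Fin (m + 1)} (ψ : Fin (m + 1) → MvPowerSeries (Fin 2) k) {c' : Fin (m + 1) → k}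
    (hc' : ∀ j, ¬ (j = a ∨ j = b) → c' j = c' a * coeff (Finsupp.single 0 1) (ψ j) + c' b * coeff (Finsupp.single 1 1) (ψ j)) :
    HasSubst (shear (Fin.predAbove a b.succ) 0 (step₂ a b ψ c')) :=
  hasSubst_shear (constantCoeff_step₂_of_ne ψ hc')

/-- **(C2) THE CHART IDENTITY.**  For a graph surface `(a, b, ψ)` and an answer `c′` in its tangent plane, with the live slot `a`:
`ρ₀ ∘ shear_{a,b}(ψ) = shear_{b′,0}(step₂) ∘ ρ_{c′,a}` on every germ `F`, where `ρ_{c′,a}` is the chart `x_l ↦ s (c′_l + y_{l′})` (`x_a ↦ c′_a s`)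
and `ρ₀` the same chart at the point `(c′_a at a, c′_b at b, 0 elsewhere)` of the graph coordinates. -/
theorem subst_chart_shear₂ {a b : Fin (m + 1)} (hab : a ≠ b) (ψ : Fin (m + 1) → MvPowerSeries (Fin 2) k)
    (hψ : ∀ j, ¬ (j = a ∨ j = b) → constantCoeff (ψ j) = 0) (c' : Fin (m + 1) → k)
    (hc' : ∀ j, ¬ (j = a ∨ j = b) → c' j = c' a * coeff (Finsupp.single 0 1) (ψ j) + c' b * coeff (Finsupp.single 1 1) (ψ j))
    (F : MvPowerSeries (Fin (m + 1)) k) :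
    subst (fun l => X 0 * (C (if l = a then c' a else if l = b then c' b else 0) +
        if l = a then (0 : MvPowerSeries (Fin (m + 1)) k) else X (Fin.predAbove a l.succ))) (subst (shear a b ψ) F) =
      subst (shear (Fin.predAbove a b.succ) 0 (step₂ a b ψ c')) (subst (fun l => X 0 * (C (c' l) +
        if l = a then (0 : MvPowerSeries (Fin (m + 1)) k) else X (Fin.predAbove a l.succ))) F) := by
  have hρ0 : HasSubst (fun l : Fin (m + 1) => X 0 * (C (if l = a then c' a else if l = b then c' b else 0) +
      if l = a then (0 : MvPowerSeries (Fin (m + 1)) k) else X (Fin.predAbove a l.succ))) :=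
    GraphCurve.hasSubst_chart (fun l => if l = a then c' a else if l = b then c' b else 0) a
  have hρ : HasSubst (fun l : Fin (m + 1) => X 0 * (C (c' l) +
      if l = a then (0 : MvPowerSeries (Fin (m + 1)) k) else X (Fin.predAbove a l.succ))) := GraphCurve.hasSubst_chart c' a
  have hS : HasSubst (shear (Fin.predAbove a b.succ) 0 (step₂ a b ψ c')) := hasSubst_shear_step₂ ψ hc'
  have hba : b ≠ a := fun h => hab h.symm
  obtain ⟨q, hq⟩ := Fin.exists_succAbove_eq hba
  have hpb : Fin.predAbove a b.succ = q.succ := by rw [← hq, RestrictedChartTransport.predAbove_succAbove_succ]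
  rw [subst_comp_subst_apply (hasSubst_shear hψ) hρ0, subst_comp_subst_apply hρ hS]
  congr 1
  funext l
  rcases Fin.eq_self_or_eq_succAbove a l with rfl | ⟨p, rfl⟩
  · -- the killed base letter: `x_a ↦ c′_a s` on both sides
    rw [shear_left, subst_X hρ0]
    simp only [if_true]
    rw [subst_mul hS, subst_X hS, shear_of_base (Or.inr rfl), subst_add hS, subst_C, ← coe_substAlgHom hS, map_zero]
  · have hj : a.succAbove p ≠ a := Fin.succAbove_ne a p
    by_cases hjb : a.succAbove p = b
    · -- the transported base letter: `x_b ↦ s (c′_b + y_{b′})` on both sides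
      have hpq : (p.succ : Fin (m + 1)) = Fin.predAbove a b.succ := by rw [← hjb, RestrictedChartTransport.predAbove_succAbove_succ]
      rw [hjb, shear_right, subst_X hρ0]
      simp only [if_neg hba, if_true]
      rw [subst_mul hS, subst_X hS, shear_of_base (Or.inr rfl), subst_add hS, subst_C, subst_X hS,
        shear_of_base (Or.inl rfl)]
    · -- a graph coordinate `x_j`, `j = a.succAbove p ∉ {a, b}`, new letter `p.succ`
      have hjab : ¬ (a.succAbove p = a ∨ a.succAbove p = b) := not_or.mpr ⟨hj, hjb⟩
      have hp0 : ¬ ((p.succ : Fin (m + 1)) = Fin.predAbove a b.succ ∨ (p.succ : Fin (m + 1)) = 0) := by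
        rintro (h | h)
        · rw [hpb] at h
          exact hjb (by rw [Fin.succ_inj.mp h, hq])
        · exact Fin.succ_ne_zero p h
      -- the two-variable identity transported to the ambient letters by `onPlane b′ 0`
      have key := X_one_mul_stepSeries₂ (hψ _ hjab) (c' a) (c' b) (c' (a.succAbove p))
      have hB : HasSubst (![X (Fin.predAbove a b.succ), X 0] : Fin 2 → MvPowerSeries (Fin (m + 1)) k) := hasSubst_base _ _
      have h1 : subst (![X (Fin.predAbove a b.succ), X 0] : Fin 2 → MvPowerSeries (Fin (m + 1)) k) (X 1 : MvPowerSeries (Fin 2) k) = X 0 := by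
        rw [subst_X hB]; rfl
      have hfam : (fun t => subst (![X (Fin.predAbove a b.succ), X 0] : Fin 2 → MvPowerSeries (Fin (m + 1)) k)
          ((![C (c' a) * X 1, X 1 * (C (c' b) + X 0)] : Fin 2 → MvPowerSeries (Fin 2) k) t)) =
          ![C (c' a) * X 0, X 0 * (C (c' b) + X (Fin.predAbove a b.succ))] := by
        funext t
        fin_cases t
        · simp [subst_mul hB, subst_X hB, subst_C]
        · simp [subst_mul hB, subst_add hB, subst_X hB, subst_C]
      have hplane : subst ![C (c' a) * X 0, X 0 * (C (c' b) + X (Fin.predAbove a b.succ))] (ψ (a.succAbove p)) =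
          X 0 * onPlane (Fin.predAbove a b.succ) 0 (stepSeries₂ (ψ (a.succAbove p)) (c' a) (c' b) (c' (a.succAbove p))) +
            C (c' (a.succAbove p)) * X 0 := by
        have key' : subst ![C (c' a) * X 1, X 1 * (C (c' b) + X 0)] (ψ (a.succAbove p)) =
            X 1 * stepSeries₂ (ψ (a.succAbove p)) (c' a) (c' b) (c' (a.succAbove p)) + C (c' (a.succAbove p)) * X 1 := by
          rw [key]; ring
        rw [← hfam, ← subst_comp_subst_apply (hasSubst_chartBase (c' a) (c' b)) hB, key', subst_add hB, subst_mul hB, h1, subst_mul hB,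
          subst_C, h1, onPlane]
      rw [shear_of_ne hjab, subst_add hρ0, subst_X hρ0, subst_onPlane _ hρ0]
      simp only [if_neg hj, if_neg hjb, if_true, if_neg hba, RestrictedChartTransport.predAbove_succAbove_succ, map_zero, zero_add, add_zero]
      rw [subst_mul hS, subst_X hS, shear_of_base (Or.inr rfl), subst_add hS, subst_C, subst_X hS, shear_of_ne hp0, step₂_succ]
      have hfam2 : (![X 0 * C (c' a), X 0 * (C (c' b) + X (Fin.predAbove a b.succ))] : Fin 2 → MvPowerSeries (Fin (m + 1)) k) =
          ![C (c' a) * X 0, X 0 * (C (c' b) + X (Fin.predAbove a b.succ))] := by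
        funext t
        fin_cases t
        · simp [mul_comm]
        · simp
      rw [hfam2, hplane]
      ring

/-- **(C3) THE NEW BASE PLANE IS PERMISSIBLE.**  If the base plane is permissible at order `c` for `shear_{a,b}(ψ)^* F` (the surface is permissible for
`F`), then at a tangent-plane answer `c′` read at the slot `a` the new base plane `V(y_{j′} : j′ ∉ {b′, 0})` is permissible at order `c` for
`shear_{b′,0}(step₂)^* (ρ_{c′,a}^* F)` (the strict transform of the surface is permissible for the transform of `F`): (C2) and part 2's transport. -/
theorem inOffPlaneIdeal_chart_step₂ {a b : Fin (m + 1)} (hab : a ≠ b) {ψ : Fin (m + 1) → MvPowerSeries (Fin 2) k} {c : ℕ}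
    {c' : Fin (m + 1) → k} {F : MvPowerSeries (Fin (m + 1)) k} (hperm : InOffPlaneIdeal a b c (subst (shear a b ψ) F))
    (hψ : ∀ j, ¬ (j = a ∨ j = b) → constantCoeff (ψ j) = 0)
    (hc' : ∀ j, ¬ (j = a ∨ j = b) → c' j = c' a * coeff (Finsupp.single 0 1) (ψ j) + c' b * coeff (Finsupp.single 1 1) (ψ j)) :
    InOffPlaneIdeal (Fin.predAbove a b.succ) 0 c (subst (shear (Fin.predAbove a b.succ) 0 (step₂ a b ψ c'))
      (subst (fun l => X 0 * (C (c' l) + if l = a then (0 : MvPowerSeries (Fin (m + 1)) k) else X (Fin.predAbove a l.succ))) F)) := by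
  have hba : b ≠ a := fun h => hab h.symm
  rw [← subst_chart_shear₂ hab ψ hψ c' hc' F]
  refine hperm.subst _ (GraphCurve.hasSubst_chart _ a) fun j hj => ?_
  -- an off-base component of `ρ₀`: `x_j ↦ s · y_{j′}` with `j′ ∉ {b′, 0}`
  have hja : j ≠ a := fun h => hj (Or.inl h)
  have hjb : j ≠ b := fun h => hj (Or.inr h)
  obtain ⟨p, rfl⟩ := Fin.exists_succAbove_eq hja
  obtain ⟨q, hq⟩ := Fin.exists_succAbove_eq hba
  simp only [if_neg hja, if_neg hjb, map_zero, zero_add, RestrictedChartTransport.predAbove_succAbove_succ]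
  refine (inOffPlaneIdeal_X_of_ne ?_).mul_left (X 0)
  rintro (h | h)
  · rw [← hq, RestrictedChartTransport.predAbove_succAbove_succ] at h
    exact hjb (by rw [Fin.succ_inj.mp h, hq])
  · exact Fin.succ_ne_zero p h

end GraphSurf

end TameFourTupleDrop

end Summit.ResolutionOfSingularities.ResolutionOfSingularities.Theorems

end
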